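import Summits.ResolutionOfSingularities.ResolutionOfSingularities.Theorems.RestrictCutPort
import HarnessLib

/-!
# RestrictCutPort2 — decomp-res RIDER «PortDischarge» (lens-4 g34, critic row 194a (MAP (M-27723) +1)), tree file
2/4 of the rider

Content VERBATIM from the decomp-res lens-4 g34 RIDER `HOME/decomp-res-lens-4/g34/FactorContactPortDischarge.lean`
(pin 9c49c6fa); HOME = run/shared/lean/pub/decomp-res; critic row 194a (MAP (M-27723) +1); landing orders INBOX
:1147/:1163 — provenance, critic text and the rider header in full in the first file, `RestrictCutPort`.  Namespace
`…Theorems.HugValuationCut`.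

## This file

Continuation 2/2 of `RestrictCutPort` (same sections of the rider, cut at the 400-line cap): carries
`factorContactPort_holds`, `factorContactPortAll_holds`, `noTameDriftingTowers_holds`.

[WRITER NOTE (decomp-res writer g12): file split only (tree files ≤ 400 lines); namespace, sections, section
variables / universes / opens and every declaration exactly as in the rider (its §105 carry and file-level
dupNamespace-linter line dropped; the `open …Theses` line lives only in the Theses-cone files `MaxContactCutPortDischarge*`).]

(Sources: Hironaka1964 Ch. III; Giraud1975; Kollar2007 3.58–3.60; CossartJannsenSaito2020 Thm. 6.40, Ch. 8;
Hauser2010Kangaroo; HauserPerlega2019 §2; CossartPiltant2008 §2; deJong1996; Hironaka2005; EGAIV2 §5 (dimension),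
EGAIV4 §16, §21; Matsumura1987 §14–§15 (dimension of quotients), §20, §28; Liu2002 §8.2 (blow-ups: integrality,
birationality, dimension); StacksProject 02ND / 0804 / 0BIQ / 031I / 0AFT.)
-/

noncomputable section

open CategoryTheory AlgebraicGeometry IsLocalRing TopologicalSpace
open Literature.AlgebraicGeometry.Resolution
open Literature.AlgebraicGeometry.Resolution.Hironaka2005 (le_idealOrder_of_mul_le le_idealOrder_of_mul_le')
open Summit.ResolutionOfSingularities.ResolutionOfSingularities.Theorems
open WeakOrderReduction ForcedTowerClasses DivergentTowerClasses MonomialTowerClasses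
open HugDimensionClasses HugDimensionKernels SurfaceShadowClasses SurfaceShadowKernels
open NearPointCut (SingularClass)
open AbsoluteContactClasses (IsAbsContactAt)
open Scheme.IdealSheafData (vanishingIdeal)
open scoped BigOperators nonZeroDivisors

namespace Summit.ResolutionOfSingularities.ResolutionOfSingularities.Theorems.HugValuationCut

section PortDischarge

variable {k : Type} [Field k]

/-! ## §113 (g34 rider · NEW · KERNEL) THE PORT `FactorContactPort n` DISCHARGED FOR EVERY WEIGHT `n ≥ 1`

Given the port's data — an in-locus principal shadow `Σ`, a stage `j` from which the top order is stable at `ν`, and an absolute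
contact witness on the TOP factor `(𝓘(Σ_j), ν)` or (on an impure shadow) on the COFACTOR `(J_j, n − ν)` — the shadow
factorization
(§112) forced to stage `m + j` (g33 `FactorAt.forcing`) reads: `ν = ν₀`, `𝓘(Σ_j)_{x} =` the weight-`ν` factor
(`principal_facIter`),
`J_j =` the stalk of the weight-`(n − ν)` factor (colon algebra in the domain `𝒪_x`), `dim 𝒪_x = 3` (§111 + §112);
the g33 transport
engine `FactorAt.regularSurfaceHugging_of_absContact` on the witnessed side (weight `ν ≥ 1`, resp. `n − ν ≥ 1` as `ν ≠ n` on an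
impure shadow) produces the hugged regular surface germ. -/

/-- **THE FACTOR-CONTACT PORT HOLDS** (KERNEL) for every weight `n ≥ 1`. (Sources: Giraud1975;
CossartJannsenSaito2020, Lem. 9.2 and
§6; EncinasVillamayor2000, Thm. 4.9; Kollar2007, 3.58–3.60.) -/
theorem factorContactPort_holds (n : ℕ) (hn : 1 ≤ n) : FactorContactPort n := by
  intro p hp k _ _ T g hB hD hbd S hL hP j ν hst htame
  obtain ⟨ν₀, K₀, h1, hle, h0, hF⟩ := S.exists_factorAt g hB hD hL hP
  have hFj := hF.forcing T g hB hD j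
  have hpr := hF.principal_facIter T g hB hD hP j
  haveI : IsRegularLocalRing ((T.St (S.m + j)).presheaf.stalk (T.pt (S.m + j))) :=
    (tower_isLocallyNoetherian_isRegular T g hB (S.m + j)).2 _
  -- the stable value IS the order of the germ: `ν = ν₀`
  have hν : ν = ν₀ := by
    have h : idealOrder (strictIter T S.m S.germ j) (T.pt (S.m + j)) = ((ν : ℕ) : ℕ∞) := hst j le_rfl
    rw [idealOrder_congr_stalk hpr.2, hFj.2.1] at h
    exact_mod_cast h.symm
  subst hν
  -- ring dimension three at `x_{m+j}`
  have hd : ringKrullDim ((T.St (S.m + j)).presheaf.stalk (T.pt (S.m + j))) = 3 := by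
    rw [tower_ringKrullDim_pt_eq T g hB hD hn (S.m + j), ← tower_ringKrullDim_pt_eq T g hB hD hn S.m]
    exact S.ringKrullDim_eq_three g hB hP
  rcases htame with htop | ⟨hnp, htail⟩
  · -- TOP-TAME: the witness sits on the weight-`ν` factor
    have habs : IsAbsContactAt (facIter T S.m ν S.germ j) ν (T.pt (S.m + j)) := by
      have h : IsAbsContactIdealAt (stalkIdeal (strictIter T S.m S.germ j) (T.pt (S.m + j))) ν := htop
      rw [hpr.2] at h
      exact h
    obtain ⟨N, rfl⟩ : ∃ N, ν = N + 1 := ⟨ν - 1, by omega⟩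
    exact hFj.regularSurfaceHugging_of_absContact T g hB hD habs hd
  · -- TAIL-TAME on an IMPURE shadow: the witness sits on the weight-`(n − ν)` factor, `n − ν ≥ 1`
    have hνn : ν ≠ n := hst.ne_of_not_pure hnp
    haveI := isDomain_of_isRegularLocalRing ((T.St (S.m + j)).presheaf.stalk (T.pt (S.m + j)))
    haveI := hpr.1
    have hGj : stalkIdeal (facIter T S.m ν S.germ j) (T.pt (S.m + j)) =
        Ideal.span {Submodule.IsPrincipal.generator (stalkIdeal (facIter T S.m ν S.germ j) (T.pt (S.m + j)))} :=
      (Ideal.span_singleton_generator _).symm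
    have hgj0 : Submodule.IsPrincipal.generator (stalkIdeal (facIter T S.m ν S.germ j) (T.pt (S.m + j))) ≠ 0 := by
      intro h0
      have htop : idealOrder (facIter T S.m ν S.germ j) (T.pt (S.m + j)) = ⊤ :=
        ENat.eq_top_iff_forall_ge.mpr fun c => (le_idealOrder_iff _ _ c).mpr
          (by rw [hGj, Ideal.span_singleton_eq_bot.mpr h0]; exact bot_le)
      rw [hFj.2.1] at htop
      exact ENat.coe_ne_top ν htop
    -- the g17 cofactor IS the stalk of the weight-`(n − ν)` factor chain
    have hcof : S.cofactorIdeal j = stalkIdeal (facIter T S.m (n - ν) K₀ j) (T.pt (S.m + j)) := by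
      show Submodule.colon (stalkIdeal (T.D (S.m + j)).ideal (T.pt (S.m + j)))
          ((stalkIdeal (strictIter T S.m S.germ j) (T.pt (S.m + j)) : Ideal _) : Set _) = _
      rw [hFj.1, hpr.2, hGj]
      exact colon_span_singleton_mul_eq hgj0 _
    have habs : IsAbsContactAt (facIter T S.m (n - ν) K₀ j) (n - ν) (T.pt (S.m + j)) := by
      have h : IsAbsContactIdealAt (S.cofactorIdeal j) (n - ν) := htail
      rw [hcof] at h
      exact h
    obtain ⟨N, hN⟩ : ∃ N, n - ν = N + 1 := ⟨n - ν - 1, by omega⟩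
    rw [hN] at hFj habs
    exact hFj.symm.regularSurfaceHugging_of_absContact T g hB hD habs hd

/-- **THE REGISTERED PORT `FactorContactPortAll` HOLDS** (KERNEL; item 27723's body). [folklore] -/
theorem factorContactPortAll_holds : FactorContactPortAll := fun n hn => factorContactPort_holds n hn

/-- by name: the g17 node statement «tame drifting towers terminate» is now unconditional. [folklore] -/
theorem noTameDriftingTowers_holds : NoTameDriftingTowers := noTameDriftingTowers_of_port factorContactPortAll_holds

end PortDischarge

end Summit.ResolutionOfSingularities.ResolutionOfSingularities.Theorems.HugValuationCut
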